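import Summits.Schanuel.Schanuel.Theorems.ZilberEacGraphLinearWitness
import Summits.Schanuel.Schanuel.Theorems.ZilberEacGraphLinearTools
import Summits.Schanuel.Schanuel.Theorems.ZilberEacPolynomialPhases
import Summits.Schanuel.Schanuel.Theorems.ZilberEacNonresonantGraphSurface
import Mathlib.Data.Nat.Periodic
import HarnessLib

/-!
# The equimodular class, XVI: EVERY `y₀`-linear fibre over EVERY polynomial graph of degree `≥ 2`
# with equal degrees is dense — growth, transcendence, or Kronecker

HONEST FRAMING.  Cell `pub-schanuel` (Zilber's Exponential-Algebraic Closedness, case ladder;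
host summit Schanuel), seat 2, gen 23.  **`unprojectedDense_graphLinearSurface`**: let
`p ∈ ℂ[X]` have degree `d ≥ 2` and let `P(x₀, y₀) = A(x₀) y₀ + B(x₀)` be irreducible with
`deg A = deg B ≥ 1`, `A, B` coprime (`lc B = -e^{τ'} lc A`).  Then the surface
`W = {x₁ = p(x₀), P(x₀, y₀) = 0} ⊆ ℂ² × ℂ²` has Zariski-dense exponential points.  NO condition on
`p` beyond its degree: by file XIII, along the exponential points `z_k` with label `k`
(`z_k ≈ τ' + 2πik`, file XV) one has `e^{p(z_k)} = e^{P̃(τ' + 2πik)}·w(1/z_k)` EXACTLY, and writing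
`e^{P̃(τ' + 2πik)} = e^{g_R(k)}·urot(g_I(k))` with real polynomials `g_R, g_I`:
* `deg g_R ≥ 1` (some order of `Re p(z_k)` survives — this includes every NON-equimodular surface and
  the non-degenerate equimodular ones): `|Re x₁| / log‖x₁‖ → ∞` and THEOREM G decides (growth);
* `g_R` constant and `g_I` with rational coefficients (RESONANCE): the phases are periodic, a
  subsequence has constant phase `ζ`, `y₁ = ζ·w(1/x₀)` exactly, and THEOREM T decides (transcendence
  of `w`, file XII);
* `g_R` constant and `g_I` with an irrational coefficient: non-density would give ONE relation
  `H(x₀, y₁) = 0` on all large labels (THEOREM H), forcing the phases to accumulate at a finite set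
  (gen 22 file IX) — impossible by file XIV (finite differences + Kronecker).
This supersedes gen 22 (parabolas) and decides the `y₀`-linear members of gen 18's residual
equimodular class over graph bases of EVERY degree.  Complete classes of instances of an OPEN question
(Mantova–Masser, PLMS 2024 §1 p. 5); fibre curves of `y₀`-degree `≥ 2` and non-graph bases are NOT
treated here; EC(3,2) OPEN; NOT Schanuel's conjecture (neither used nor implied; EAC ⇏ SC).
-/

noncomputable section

open Filter Topology Set Complex MvPolynomial
open Literature.NumberTheory.Transcendental Literature.ModelTheory.Zilber
open Literature.ModelTheory.ExponentialFields

set_option linter.dupNamespace false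

namespace Summit.Schanuel.Schanuel.Theorems

section Main

variable (A B : Polynomial ℂ) {P : MvPolynomial (Fin 2) ℂ}

/-- **EVERY `y₀`-LINEAR FIBRE WITH EQUAL DEGREES OVER EVERY POLYNOMIAL GRAPH OF DEGREE `≥ 2` IS
DENSE.**  `P(x₀, y₀) = A(x₀) y₀ + B(x₀)` irreducible, `deg A = deg B ≥ 1`, `A, B` coprime,
`lc B = -e^{τ'} lc A`; `p ∈ ℂ[X]`, `deg p ≥ 2`.  Then `{x₁ = p(x₀), P(x₀, y₀) = 0}` has Zariski-dense
exponential points (growth / transcendence / Kronecker trichotomy; see the module docstring).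
[cite: MantovaMasser2023, §1 Further remarks, p. 5 (the question, open in general)] (new) -/
theorem unprojectedDense_graphLinearSurface
    (hP : ∀ x y : ℂ, MvPolynomial.eval ![x, y] P = A.eval x * y + B.eval x) (hirr : Irreducible P)
    (hN : 1 ≤ A.natDegree) (hdeg : B.natDegree = A.natDegree) (hcop : IsCoprime A B)
    (p : Polynomial ℂ) (hd : 2 ≤ p.natDegree) (τ' : ℂ)
    (hlc : B.leadingCoeff = -Complex.exp τ' * A.leadingCoeff) :
    UnprojectedDense {w : Fin 2 ⊕ Fin 2 → ℂ | w (Sum.inl 1) = p.eval (w (Sum.inl 0)) ∧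
      MvPolynomial.eval ![w (Sum.inl 0), w (Sum.inr 0)] P = 0} := by
  classical
  -- the witness and the labelled exponential points
  obtain ⟨Pt, w, R, -, -, -, hw, hw0, hK2, htr⟩ := exists_graph_witness A B hN hdeg hcop p hd τ' hlc
  obtain ⟨k₀, z, hzlab, hzeq, hzR, hznorm, hzup⟩ := exists_labelled_expPoints A B hN hdeg τ' hlc R
  -- the phase polynomial `k ↦ P̃(τ' + 2πik)` and its real and imaginary parts
  set PK : Polynomial ℂ := Pt.comp (Polynomial.C τ' + Polynomial.C (2 * Real.pi * I) * Polynomial.X)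
    with hPK
  have hPKev : ∀ k : ℕ, PK.eval (((k : ℝ) : ℂ)) = Pt.eval (τ' + (((k : ℕ) : ℤ) : ℂ) * (2 * Real.pi * I)) := by
    intro k
    rw [hPK, Polynomial.eval_comp]
    simp only [Polynomial.eval_add, Polynomial.eval_mul, Polynomial.eval_C, Polynomial.eval_X]
    push_cast
    ring_nf
  obtain ⟨gR, gI, hgR, hexpPK⟩ := exists_re_im_polynomials PK
  -- the exact identity with labels `k₀ + m`
  have hid : ∀ m, Complex.exp (p.eval (z m)) =
      urot (gI.eval ((k₀ + m : ℕ) : ℝ)) *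
        ((Real.exp (gR.eval ((k₀ + m : ℕ) : ℝ)) : ℂ) * w (z m)⁻¹) := by
    intro m
    obtain ⟨k', hk'lab, hk'⟩ := hK2 (z m) (hzR m) (hzeq m)
    have hkk : k' = ((k₀ + m : ℕ) : ℤ) :=
      int_eq_of_norm_sub_lt hk'lab (by exact_mod_cast hzlab m)
    rw [hk', hkk, ← hPKev, hexpPK]
    ring
  -- the sequence of exponential points of the surface
  have hirr3 := irreducible_rename_castSucc₂ hirr
  have hS := isIrreducibleClosed_graphSurface p hirr3
  have hdim := zariskiDim_graphSurface p hirr3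
  rw [fibreCurveSurface_eq]
  set S := {w : Fin 2 ⊕ Fin 2 → ℂ | w (Sum.inl 1) = p.eval (w (Sum.inl 0)) ∧
      MvPolynomial.eval ![w (Sum.inl 0), w (Sum.inr 0), w (Sum.inr 1)]
        (rename (Fin.castSucc : Fin 2 → Fin 3) P) = 0} with hSdef
  set q : ℕ → Fin 2 ⊕ Fin 2 → ℂ := fun m =>
    Sum.elim ![z m, p.eval (z m)] ![Complex.exp (z m), Complex.exp (p.eval (z m))] with hq
  have hqS : ∀ m, q m ∈ S := by
    intro m
    refine ⟨by simp [hq], ?_⟩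
    have ev : (![q m (Sum.inl 0), q m (Sum.inr 0), q m (Sum.inr 1)] : Fin 3 → ℂ) =
        ![z m, Complex.exp (z m), Complex.exp (p.eval (z m))] := by
      simp [hq]
    rw [ev, eval_vec3_rename_castSucc, hP]
    exact hzeq m
  have hqΓ : ∀ m, q m ∈ expGraph ℂ 2 := by
    intro m
    rw [mem_expGraph_iff]
    intro i
    rw [Literature.ModelTheory.ExponentialFields.ExponentialRing.complex_exp_eq]
    fin_cases i <;> simp [hq]
  have hwlim : Tendsto (fun m => w (z m)⁻¹) atTop (𝓝 (w 0)) :=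
    hw.continuousAt.tendsto.comp (tendsto_inv₀_cobounded.comp (tendsto_norm_atTop_iff_cobounded.1 hznorm))
  by_cases hgRdeg : 1 ≤ gR.natDegree
  · /- (a) GROWTH: some order of `Re p(z_k)` survives; THEOREM G -/
    -- `Re p(z_m) = g_R(k₀ + m) + log ‖w(1/z_m)‖`
    have hre : ∀ m, (p.eval (z m)).re = gR.eval ((k₀ + m : ℕ) : ℝ) + Real.log ‖w (z m)⁻¹‖ := by
      intro m
      have h1 := congrArg (fun x : ℂ => Real.log ‖x‖) (hid m)
      simp only [Complex.norm_exp, Real.log_exp, norm_mul, norm_urot, one_mul, Complex.norm_real,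
        Real.norm_eq_abs, Real.abs_exp] at h1
      rw [h1, Real.log_mul (Real.exp_pos _).ne' (norm_ne_zero_iff.2 (hw0 _)), Real.log_exp]
    -- the logarithms `log ‖w(1/z_m)‖` are bounded
    have hloglim : Tendsto (fun m => Real.log ‖w (z m)⁻¹‖) atTop (𝓝 (Real.log ‖w 0‖)) :=
      (Real.continuousAt_log (norm_ne_zero_iff.2 (hw0 0))).tendsto.comp hwlim.norm
    obtain ⟨M, hM⟩ : ∃ M : ℝ, ∀ m, |Real.log ‖w (z m)⁻¹‖| ≤ M := by
      obtain ⟨C, hC⟩ := isBounded_iff_forall_norm_le.1 (Metric.isBounded_range_of_tendsto _ hloglim)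
      exact ⟨C, fun m => by simpa [Real.norm_eq_abs] using hC _ ⟨m, rfl⟩⟩
    have ha : ∀ m, |(p.eval (z m)).re - gR.eval ((k₀ + m : ℕ) : ℝ)| ≤ M := by
      intro m; rw [hre m, add_sub_cancel_left]; exact hM m
    -- the denominator
    obtain ⟨D, hD, hLD⟩ := log_two_add_norm_eval_le_log_label p (α := ‖τ'‖ + 1) (by positivity)
    have hgr : Tendsto (fun m => |(p.eval (z m)).re| / Real.log (2 + ‖p.eval (z m)‖)) atTop atTop :=
      tendsto_abs_div_log_of_linear_growth hgRdeg k₀ hD ha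
        (fun m => Real.log_le_log two_pos (by linarith [norm_nonneg (p.eval (z m))]))
        (fun m => hLD (z m) _ (Nat.cast_nonneg _) (hzup m))
    refine unprojectedDense_of_growth hS (le_of_eq hdim) 1 hqS hqΓ ?_
    refine hgr.congr fun m => ?_
    simp [hq]
  · /- `g_R` is constant: the modulus of the phase factor is constant -/
    have hgR0 : gR.natDegree = 0 := by omega
    set r₀ : ℝ := gR.coeff 0 with hr₀
    have hgRev : ∀ x : ℝ, gR.eval x = r₀ := fun x => by
      rw [Polynomial.eq_C_of_natDegree_eq_zero hgR0, Polynomial.eval_C]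
    set c₀ : ℂ := ((Real.exp r₀ : ℝ) : ℂ) with hc₀
    have hc₀0 : c₀ ≠ 0 := by rw [hc₀]; exact_mod_cast (Real.exp_pos r₀).ne'
    have hid' : ∀ m, Complex.exp (p.eval (z m)) =
        urot (gI.eval ((k₀ + m : ℕ) : ℝ)) * (c₀ * w (z m)⁻¹) := by
      intro m; rw [hid m, hgRev]
    rcases urot_eval_periodic_or_not_near_finset gI with ⟨Dp, hDp, hper⟩ | hfar
    · /- (b) RESONANCE: periodic phases; constant phase on a subsequence; THEOREM T -/
      set phase : ℕ → ℂ := fun k => urot (gI.eval (k : ℝ)) with hphase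
      have hperiodic : Function.Periodic phase Dp := fun k => hper k
      set g : ℕ → Fin Dp := fun m => ⟨(k₀ + m) % Dp, Nat.mod_lt _ hDp⟩ with hg
      obtain ⟨i₀, hi₀⟩ := Finite.exists_infinite_fiber g
      have hSinf : Set.Infinite (g ⁻¹' {i₀}) := Set.infinite_coe_iff.1 hi₀
      set ζ : ℂ := phase (i₀ : ℕ) * c₀ with hζ
      have hζ0 : ζ ≠ 0 := mul_ne_zero (by rw [hphase]; exact (norm_pos_iff.1 (by rw [norm_urot]; norm_num)))
        hc₀0
      have hphase_eq : ∀ m, g m = i₀ → phase (k₀ + m) = phase (i₀ : ℕ) := by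
        intro m hm
        have h1 : ((i₀ : ℕ)) = (k₀ + m) % Dp := by rw [← hm]
        rw [h1]
        exact (hperiodic.map_mod_nat (k₀ + m)).symm
      -- the subsequence of constant phase
      set φ : ℕ → ℕ := Nat.nth (· ∈ g ⁻¹' {i₀}) with hφ
      have hφS : ∀ j, g (φ j) = i₀ := fun j => Nat.nth_mem_of_infinite (p := (· ∈ g ⁻¹' {i₀})) hSinf j
      have hφtop : Tendsto φ atTop atTop :=
        (Nat.nth_strictMono (p := (· ∈ g ⁻¹' {i₀})) hSinf).tendsto_atTop
      have hqnorm : Tendsto (fun j => ‖q (φ j) (Sum.inl 0)‖) atTop atTop := by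
        refine (hznorm.comp hφtop).congr fun j => ?_
        simp [hq]
      have hw' : AnalyticAt ℂ (fun u => ζ * w u) 0 := analyticAt_const.mul hw
      have hrel : ∀ j, q (φ j) (Sum.inr 1) = (fun u => ζ * w u) (q (φ j) (Sum.inl 0))⁻¹ := by
        intro j
        simp only [hq, Sum.elim_inr, Sum.elim_inl, Matrix.cons_val_one, Matrix.cons_val_zero]
        rw [hid' (φ j), hζ]
        have := hphase_eq (φ j) (hφS j)
        simp only [hphase, Nat.cast_add] at this
        push_cast
        rw [this]
        ring
      exact unprojectedDense_of_transcendental_relation hS (le_of_eq hdim) 0 1 (fun j => hqS (φ j))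
        (fun j => hqΓ (φ j)) hqnorm hw' hrel (transcendental_const_mul hζ0 htr)
    · /- (c) NON-RESONANCE: a relation on all large labels would make the phases accumulate -/
      by_contra hnot
      have hex : ∃ f, f ∈ vanishingIdeal ℂ (S ∩ expGraph ℂ 2) ∧ f ∉ vanishingIdeal ℂ S := by
        by_contra h
        push Not at h
        exact hnot (le_antisymm h (vanishingIdeal_anti_mono Set.inter_subset_left))
      obtain ⟨f, hfΓ, hfS⟩ := hex
      -- THEOREM H: one relation on all points
      obtain ⟨H, hH0, hH⟩ := exists_polyPoly_relation_of_forall_aeval_eq_zero hS (le_of_eq hdim) hqS hfS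
        (fun m => (mem_vanishingIdeal_iff.1 hfΓ) _ ⟨hqS m, hqΓ m⟩) (Sum.inl 0) (Sum.inr 1)
      set e : ℕ → ℂ := fun m => urot (gI.eval ((k₀ + m : ℕ) : ℝ)) with he
      have he1 : ∀ m, ‖e m‖ = 1 := fun m => norm_urot _
      have hrel : ∀ m, (H.map (Polynomial.evalRingHom (z m))).eval (e m * (c₀ * w (z m)⁻¹)) = 0 := by
        intro m
        have h1 := hH m
        simp only [hq, Sum.elim_inl, Sum.elim_inr, Matrix.cons_val_zero, Matrix.cons_val_one] at h1
        rwa [hid' m] at h1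
      -- the phases accumulate at a finite set …
      have hwlim' : Tendsto (fun m => c₀ * w (z m)⁻¹) atTop (𝓝 (c₀ * w 0)) := hwlim.const_mul c₀
      obtain ⟨F, hF⟩ := phases_near_finset_of_relation hH0 hznorm he1 (mul_ne_zero hc₀0 (hw0 0)) hwlim' hrel
      -- … but the non-resonant phase sequence does not
      obtain ⟨ε, hε, hfar'⟩ := hfar F
      obtain ⟨m₀, hm₀⟩ := Filter.eventually_atTop.1 (hF ε hε)
      obtain ⟨k, hk, hkfar⟩ := hfar' (k₀ + m₀)
      obtain ⟨ζ, hζF, hζ⟩ := hm₀ (k - k₀) (by omega)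
      have hkk : k₀ + (k - k₀) = k := by omega
      rw [he] at hζ
      simp only [hkk] at hζ
      exact absurd hζ (not_lt.2 (hkfar ζ hζF))

/-- **Case ∧ dense for every `y₀`-linear fibre with equal degrees over every polynomial graph of
degree `≥ 2`.** [cite: MantovaMasser2023, §1 Further remarks, p. 5 (the question, open in general)]
(new) -/
theorem unprojectedDensityQuestion_graphLinearSurface
    (hP : ∀ x y : ℂ, MvPolynomial.eval ![x, y] P = A.eval x * y + B.eval x) (hirr : Irreducible P)
    (hN : 1 ≤ A.natDegree) (hdeg : B.natDegree = A.natDegree) (hcop : IsCoprime A B)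
    (p : Polynomial ℂ) (hd : 2 ≤ p.natDegree) (τ' : ℂ)
    (hlc : B.leadingCoeff = -Complex.exp τ' * A.leadingCoeff) :
    MMCaseDimPiOneFree {w : Fin 2 ⊕ Fin 2 → ℂ | w (Sum.inl 1) = p.eval (w (Sum.inl 0)) ∧
      MvPolynomial.eval ![w (Sum.inl 0), w (Sum.inr 0)] P = 0} ∧
    UnprojectedDense {w : Fin 2 ⊕ Fin 2 → ℂ | w (Sum.inl 1) = p.eval (w (Sum.inl 0)) ∧
      MvPolynomial.eval ![w (Sum.inl 0), w (Sum.inr 0)] P = 0} := by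
  refine ⟨mmCase_fibreCurveSurface _ hd hirr ?_,
    unprojectedDense_graphLinearSurface A B hP hirr hN hdeg hcop p hd τ' hlc⟩
  have hA0 : A ≠ 0 := by
    intro h; rw [h, Polynomial.natDegree_zero] at hN; omega
  have hB0 : B ≠ 0 := by
    intro h
    rw [h, Polynomial.leadingCoeff_zero] at hlc
    exact mul_ne_zero (neg_ne_zero.2 (Complex.exp_ne_zero _)) (Polynomial.leadingCoeff_ne_zero.2 hA0)
      hlc.symm
  refine ((Polynomial.finite_setOf_isRoot (mul_ne_zero hA0 hB0)).infinite_compl).mono ?_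
  intro t ht
  simp only [Set.mem_compl_iff, Set.mem_setOf_eq, Polynomial.IsRoot, Polynomial.eval_mul,
    mul_eq_zero, not_or] at ht
  have hA : A.eval t ≠ 0 := ht.1
  refine ⟨-B.eval t / A.eval t, div_ne_zero (neg_ne_zero.2 ht.2) hA, ?_⟩
  rw [hP, mul_div_cancel₀ _ hA, neg_add_cancel]

end Main

end Summit.Schanuel.Schanuel.Theorems
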